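import Mathlib
import Summits.NavierStokesRegularity.NavierStokesRegularity.Theorems.EulerZoomLiouvillePowerGaugeEulerLiouvilleSwirlCapacityPlaneLogKernel
import HarnessLib

/-!
# Crux `EulerZoomLiouville.PowerGaugeEulerLiouville` (stmt-NavierStokesRegularity-19832), line `swirl-capacity`, stub D2 (log-sharp form) —
# tool 4: THE PLANAR LOGARITHMIC CAPACITY INEQUALITY FROM A RAY BOUND

Route №10 `EulerZoomLiouville` (NavierStokesRegularity), crux E, line `swirl-capacity`, registered stub `stub_axisCapacityFloor` (D2, log-sharp).
ABSTRACT POTENTIAL DUALITY.  Let `B` be a measurable subset of the disc `|·| ≤ R`, `g ≥ 0` measurable on `B` (think `g = ‖∇u‖` on a box), and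
`S ⊆ B` a measurable set of area `≥ L > 0` on which the RAY BOUND `c ≤ ∫_B g(x) dA(x)/|x − y|` holds (`y ∈ S`; for a compactly supported `u` with
`u ≥ γ₀` on `S` this is the ray representation with `c = 2πγ₀`; for a function vanishing on a line it is the sector version with `c = πγ₀/3`).
Then (`lintegral_sq_ge_of_ray_bound`)
`∫_B g² ≥ c² / (2π (3 + log (16πR²/L)))`:
integrate the ray bound over `S` (`c|S| ≤ ∫_B g · U_S`, `U_S(x) = ∫_S dA(y)/|x−y|`, Tonelli), Cauchy–Schwarz, and the double two-pole bound
`‖U_S‖²_{L²(B)} ≤ ∬_{S×S} K ≤ 2π|S|²(3 + log(16πR²/|S|))` of `…SwirlCapacityPlaneLogKernel.doublePole_le`; the `|S|²` cancels and only the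
LOGARITHM of `R²/|S|` survives — the planar logarithmic capacity of an arbitrary measurable set (cf. Maz'ya's capacity–area inequality), by
elementary potential theory.

WHAT THIS IS NOT: not NS, not the crux, not yet D2 — a `--supports` tool for stmt-19832 (pure real analysis in the plane); no summit statement is
proved here.  [folklore; cf. Mazja1985 §2.2.3 (6)]
-/

noncomputable section

-- flat `Theorems/<Route><Decl>…` files of one crux share the namespace of the crux (tree convention)
set_option linter.dupNamespace false

open MeasureTheory Set Filter Topology Metric Function Real
open scoped NNReal ENNReal

namespace Summit.NavierStokesRegularity.NavierStokesRegularity.Theorems.PowerGaugeEulerLiouville.SwirlCapacity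

/-- The Newtonian kernel `(x, y) ↦ |x − y|⁻¹` (real-valued, `0` on the diagonal) is measurable on `ℂ × ℂ`, in `ℝ≥0∞`. [folklore] -/
theorem measurable_kernel : Measurable fun p : ℂ × ℂ => ENNReal.ofReal ‖p.1 - p.2‖⁻¹ :=
  ENNReal.measurable_ofReal.comp ((continuous_fst.sub continuous_snd).norm.measurable.inv)

/-- **THE PLANAR LOGARITHMIC CAPACITY INEQUALITY FROM A RAY BOUND.**  `B ⊆ B̄(0,R)`, `g` measurable, `S ⊆ B` measurable with
`|S| ≥ L > 0`, and for every `y ∈ S` the ray bound `c ≤ ∫_B g(x) |x − y|⁻¹ dA(x)` (`c > 0`).  Then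
`c² / (2π (3 + log (16πR²/L))) ≤ ∫_B g²`. [folklore] -/
theorem lintegral_sq_ge_of_ray_bound {R c L : ℝ} (hR : 0 < R) (hc : 0 < c) (hL : 0 < L)
    {B S : Set ℂ} (hSm : MeasurableSet S) (hSB : S ⊆ B) (hBR : B ⊆ closedBall (0 : ℂ) R)
    {g : ℂ → ℝ≥0∞} (hg : Measurable g)
    (hray : ∀ y ∈ S, ENNReal.ofReal c ≤ ∫⁻ x in B, g x * ENNReal.ofReal ‖x - y‖⁻¹)
    (hLS : ENNReal.ofReal L ≤ volume S) :
    ENNReal.ofReal (c ^ 2 / (2 * π * (3 + Real.log (16 * π * R ^ 2 / L)))) ≤ ∫⁻ x in B, g x ^ 2 := by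
  -- the area of `S`
  have hSR : S ⊆ closedBall (0 : ℂ) R := hSB.trans hBR
  obtain ⟨hSfin, hmle⟩ := volume_toReal_le_of_subset_closedBall hR hSR
  set m : ℝ := (volume S).toReal with hm
  have hmS : volume S = ENNReal.ofReal m := (ENNReal.ofReal_toReal hSfin).symm
  have hLm : L ≤ m := by
    have := ENNReal.toReal_mono hSfin hLS
    rwa [ENNReal.toReal_ofReal hL.le] at this
  have hm0 : 0 < m := hL.trans_le hLm
  -- the logarithms
  have hℓL : Real.log 16 ≤ Real.log (16 * π * R ^ 2 / L) := by
    refine Real.log_le_log (by norm_num) ?_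
    rw [le_div_iff₀ hL]
    nlinarith [Real.pi_gt_three, hLm, hmle]
  have hlog16 : 0 < Real.log 16 := Real.log_pos (by norm_num)
  have hℓpos : 0 < 3 + Real.log (16 * π * R ^ 2 / L) := by linarith
  have hℓmono : Real.log (16 * π * R ^ 2 / m) ≤ Real.log (16 * π * R ^ 2 / L) := by
    refine Real.log_le_log (by positivity) ?_
    exact div_le_div_of_nonneg_left (by positivity) hL hLm
  -- the energy; trivial if infinite
  set E : ℝ≥0∞ := ∫⁻ x in B, g x ^ 2 with hE
  rcases eq_or_ne E ⊤ with hEtop | hEtop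
  · rw [hEtop]; exact le_top
  -- the potential of `S`
  set k : ℂ → ℂ → ℝ≥0∞ := fun x y => ENNReal.ofReal ‖x - y‖⁻¹ with hk
  have hkm : Measurable (uncurry k) := measurable_kernel
  have hkm2 : ∀ x, Measurable (k x) := fun x => hkm.comp (measurable_const.prodMk measurable_id)
  set U : ℂ → ℝ≥0∞ := fun x => ∫⁻ y in S, k x y with hU
  have hUm : Measurable U := Measurable.lintegral_prod_right' (ν := volume.restrict S) hkm
  -- step 1: integrate the ray bound over `S` and swap (Tonelli)
  have h1 : ENNReal.ofReal c * volume S ≤ ∫⁻ x in B, g x * U x := by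
    have hsw : AEMeasurable (uncurry fun (y : ℂ) (x : ℂ) => g x * k x y)
        ((volume.restrict S).prod (volume.restrict B)) := by
      refine Measurable.aemeasurable ?_
      exact (hg.comp measurable_snd).mul (hkm.comp (measurable_snd.prodMk measurable_fst))
    calc ENNReal.ofReal c * volume S = ∫⁻ _ in S, ENNReal.ofReal c := (setLIntegral_const S _).symm
      _ ≤ ∫⁻ y in S, ∫⁻ x in B, g x * k x y := setLIntegral_mono' hSm fun y hy => hray y hy
      _ = ∫⁻ x in B, ∫⁻ y in S, g x * k x y := lintegral_lintegral_swap hsw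
      _ = ∫⁻ x in B, g x * U x := by
          refine lintegral_congr fun x => ?_
          rw [lintegral_const_mul _ (hkm2 x)]
  -- step 2: Cauchy–Schwarz
  have h2 : ∫⁻ x in B, g x * U x ≤ E ^ (1 / 2 : ℝ) * (∫⁻ x in B, U x ^ 2) ^ (1 / 2 : ℝ) := by
    have h := ENNReal.lintegral_mul_le_Lp_mul_Lq (volume.restrict B) Real.HolderConjugate.two_two hg.aemeasurable hUm.aemeasurable
    simp only [Pi.mul_apply, ENNReal.rpow_two] at h
    exact h
  -- step 3: `‖U‖²_{L²(B)}` is the double two-pole integral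
  have h3 : ∫⁻ x in B, U x ^ 2 ≤ ENNReal.ofReal (2 * π * m ^ 2 * (3 + Real.log (16 * π * R ^ 2 / m))) := by
    have hprod : ∀ x, U x ^ 2 = ∫⁻ y in S, ∫⁻ y' in S, k x y * k x y' := by
      intro x
      rw [sq, hU]
      beta_reduce
      rw [← lintegral_mul_const _ (hkm2 x)]
      refine lintegral_congr fun y => ?_
      rw [lintegral_const_mul _ (hkm2 x)]
    -- measurability for the two swaps
    have hm3 : Measurable fun q : (ℂ × ℂ) × ℂ => k q.1.1 q.1.2 * k q.1.1 q.2 :=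
      (hkm.comp measurable_fst).mul (hkm.comp ((measurable_fst.comp measurable_fst).prodMk measurable_snd))
    have hinner_m : Measurable fun p : ℂ × ℂ => ∫⁻ y' in S, k p.1 p.2 * k p.1 y' :=
      Measurable.lintegral_prod_right' (ν := volume.restrict S) hm3
    have hsw1 : AEMeasurable (uncurry fun (x : ℂ) (y : ℂ) => ∫⁻ y' in S, k x y * k x y')
        ((volume.restrict B).prod (volume.restrict S)) := hinner_m.aemeasurable
    have hsw2 : ∀ y, AEMeasurable (uncurry fun (x : ℂ) (y' : ℂ) => k x y * k x y')
        ((volume.restrict B).prod (volume.restrict S)) := by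
      intro y
      refine Measurable.aemeasurable ?_
      exact (hkm.comp (measurable_fst.prodMk measurable_const)).mul (hkm.comp (measurable_fst.prodMk measurable_snd))
    calc ∫⁻ x in B, U x ^ 2 = ∫⁻ x in B, ∫⁻ y in S, ∫⁻ y' in S, k x y * k x y' := lintegral_congr fun x => hprod x
      _ = ∫⁻ y in S, ∫⁻ x in B, ∫⁻ y' in S, k x y * k x y' := lintegral_lintegral_swap hsw1
      _ = ∫⁻ y in S, ∫⁻ y' in S, ∫⁻ x in B, k x y * k x y' := by
          refine lintegral_congr fun y => ?_
          exact lintegral_lintegral_swap (hsw2 y)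
      _ ≤ ∫⁻ y in S, ∫⁻ y' in S, ∫⁻ x in closedBall (0 : ℂ) R, ENNReal.ofReal (‖x - y‖⁻¹ * ‖x - y'‖⁻¹) := by
          refine lintegral_mono fun y => lintegral_mono fun y' => ?_
          refine (lintegral_mono_set hBR).trans (le_of_eq ?_)
          refine lintegral_congr fun x => ?_
          rw [hk]
          beta_reduce
          rw [← ENNReal.ofReal_mul (inv_nonneg.2 (norm_nonneg _))]
      _ ≤ ENNReal.ofReal (2 * π * m ^ 2 * (3 + Real.log (16 * π * R ^ 2 / m))) := doublePole_le hR hSm hSR hm0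
  -- step 4: put together and cancel `m²`
  have hlogm : 0 ≤ 3 + Real.log (16 * π * R ^ 2 / m) := by
    have : Real.log 16 ≤ Real.log (16 * π * R ^ 2 / m) := by
      refine Real.log_le_log (by norm_num) ?_
      rw [le_div_iff₀ hm0]
      nlinarith [Real.pi_gt_three, hmle]
    linarith
  set Φ : ℝ := 2 * π * m ^ 2 * (3 + Real.log (16 * π * R ^ 2 / L)) with hΦ
  have hΦ0 : 0 < Φ := by positivity
  have h3' : ∫⁻ x in B, U x ^ 2 ≤ ENNReal.ofReal Φ :=
    h3.trans (ENNReal.ofReal_le_ofReal (by rw [hΦ]; gcongr))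
  have hchain : ENNReal.ofReal (c * m) ≤ E ^ (1 / 2 : ℝ) * ENNReal.ofReal Φ ^ (1 / 2 : ℝ) := by
    calc ENNReal.ofReal (c * m) = ENNReal.ofReal c * volume S := by rw [hmS, ENNReal.ofReal_mul hc.le]
      _ ≤ ∫⁻ x in B, g x * U x := h1
      _ ≤ E ^ (1 / 2 : ℝ) * (∫⁻ x in B, U x ^ 2) ^ (1 / 2 : ℝ) := h2
      _ ≤ E ^ (1 / 2 : ℝ) * ENNReal.ofReal Φ ^ (1 / 2 : ℝ) := by gcongr
  -- square
  have hsq : ENNReal.ofReal (c * m) ^ 2 ≤ E * ENNReal.ofReal Φ := by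
    have h := mul_le_mul' hchain hchain
    have e1 : E ^ (1 / 2 : ℝ) * ENNReal.ofReal Φ ^ (1 / 2 : ℝ) * (E ^ (1 / 2 : ℝ) * ENNReal.ofReal Φ ^ (1 / 2 : ℝ)) =
        E * ENNReal.ofReal Φ := by
      have hE2 : E ^ (1 / 2 : ℝ) * E ^ (1 / 2 : ℝ) = E := by
        rw [← ENNReal.rpow_add_of_nonneg _ _ (by norm_num) (by norm_num)]; norm_num
      have hΦ2 : ENNReal.ofReal Φ ^ (1 / 2 : ℝ) * ENNReal.ofReal Φ ^ (1 / 2 : ℝ) = ENNReal.ofReal Φ := by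
        rw [← ENNReal.rpow_add_of_nonneg _ _ (by norm_num) (by norm_num)]; norm_num
      calc E ^ (1 / 2 : ℝ) * ENNReal.ofReal Φ ^ (1 / 2 : ℝ) * (E ^ (1 / 2 : ℝ) * ENNReal.ofReal Φ ^ (1 / 2 : ℝ))
          = (E ^ (1 / 2 : ℝ) * E ^ (1 / 2 : ℝ)) * (ENNReal.ofReal Φ ^ (1 / 2 : ℝ) * ENNReal.ofReal Φ ^ (1 / 2 : ℝ)) := by ring
        _ = E * ENNReal.ofReal Φ := by rw [hE2, hΦ2]
    rw [sq, ← e1]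
    exact h
  -- read off in `ℝ`
  set e : ℝ := E.toReal with he
  have hEe : E = ENNReal.ofReal e := (ENNReal.ofReal_toReal hEtop).symm
  rw [hEe, ← ENNReal.ofReal_pow (by positivity), ← ENNReal.ofReal_mul ENNReal.toReal_nonneg] at hsq
  have hsq' : (c * m) ^ 2 ≤ e * Φ := (ENNReal.ofReal_le_ofReal_iff (by positivity)).1 hsq
  rw [hEe]
  refine ENNReal.ofReal_le_ofReal ?_
  rw [div_le_iff₀ (by positivity)]
  -- `(c m)² ≤ e · 2π m² (3 + ℓ)` ⇒ `c² ≤ e · 2π (3 + ℓ)`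
  have hm2 : 0 < m ^ 2 := by positivity
  have key : c ^ 2 * m ^ 2 ≤ (e * (2 * π * (3 + Real.log (16 * π * R ^ 2 / L)))) * m ^ 2 := by
    calc c ^ 2 * m ^ 2 = (c * m) ^ 2 := by ring
      _ ≤ e * Φ := hsq'
      _ = (e * (2 * π * (3 + Real.log (16 * π * R ^ 2 / L)))) * m ^ 2 := by rw [hΦ]; ring
  exact le_of_mul_le_mul_right key hm2

end Summit.NavierStokesRegularity.NavierStokesRegularity.Theorems.PowerGaugeEulerLiouville.SwirlCapacity

end
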